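import Literature.IUT.HodgeArakelov.PlusMinusTowerCoverModelCore
import Literature.IUT.HodgeArakelov.PlusMinusTowerCoverModelCore2
import Literature.IUT.HodgeArakelov.PlusMinusTowerCoverModelResidual
import Literature.AnabelianGeometry.EtaleTheta.MuTwoSettingPiCData

/-!
# B14 «PlusMinusTower.ofCoverModel»: the GENUINE `±`-tower of [IUTchII] Def. 2.3 (i) at `v ∈ V^bad`, built from the
# [EtTh] tempered data (`Π^tp_C ⊇ Π^tp_X ⊇ Π^tp_X̲ ⊇ Π^tp_X̲̲`) inside a profinite completion of `Π^tp_C`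

S. Mochizuki, *Inter-universal Teichmüller theory II*, kurims manuscript (Dec. 2020), §2, Def. 2.3 (i) p. 67
([IUTchII] Def 2.3 (i), kurims p.67) [claim: Mochizuki2012, status: disputed] (D-0012 claim key; series status DISPUTED — a
CONSTRUCTION in classical profinite group theory over abc-iut-L2's [EtTh] data; nothing of the series is asserted);
[EtTh] §2 pp. 36–39 [cite: MochizukiEtTh2009, Def 2.1 p.36]; [SemiAnbd] §6 p. 69 [cite: MochizukiSemiAnbd2006, §6 p.69].
abc-iut cell, seat abc-iut-L6-t19 gen 5 — MERGE-MAP row **B14** (abc-iut-L6-lead §F v1.19e (3): HOLDER-DESIGNATE; design note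
HOME/staging/L6/L6-t19/B14-DESIGN.md).  DEF-BEARING (post-freeze def, reading (ii)): three `def`s, no new `Prop` facts, no instances.

## What is constructed

For abc-iut-L2-t1's `M : MuTwoSetting p` (`Π^tp_X ↪ Π^tp_C`, index `2`), abc-iut-L2-d3's `e : M.CLevelData` (open embedding +
augmentation `augC : Π^tp_C → G_{ℚ_p}`), abc-iut-L2-t8's `C : DoubleUnderline l` (`Π^tp_X̲̲ = C.Huu`) with the [IUTchII] §1 side data, and
the print-level Prop. 2.1 model `S := BadPlaceSetting.ofUnderline C μ …` (p420095; `Π_v = Π^tp_X̲̲`, `Π^tp_{X_v} = Π^tp_X̲ = GtpXu l` —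
F-L6t19g5-1: the §2 curve is `X̲_v` of type `(1,l-tors)`), and for ANY Prop. 2.1 output `T : TemperedCoverings S P`:

* `TemperedCoverings.refIso T : P ≃ Π_v`, `TemperedCoverings.plainIso T : Π^tp_{X_v}(P) ≃ Π^tp_X̲` — a CHOSEN pair of identifications
  from the field `corresponds` (`plainIso_incl`, `map_plainIso_Y`, `map_plainIso_Ydd`);
* **`PlusMinusTower.ofCoverModel`** `… ι hι hinj Φ hΦ hΦK hZ hN T : PlusMinusTower T` over the PARAMETERS
  `ι : Π^tp_C → Q` an injective profinite completion (abc-iut-L3's `IsProfiniteCompletion`; exists: p423691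
  `exists_injective_completion_of_isOpenEmbedding`, or abc-iut-L2-d3's canonical `toPiCHat`) and `Φ : Q → G_{ℚ_p}` extending `augC`
  with `Φ(Q) = G_K` (exists: p424688 `exists_augHat`; abc-iut-L2-d3's `PiCData.aug`): `Π̂^cor_v := Q`, `Π^cor_v := ι(Π^tp_C)`,
  `Π̂^±_v := cl ι(inclX Π^tp_X̲)`, `Π̂_v := cl ι(inclX Π^tp_X̲̲)`, `emb := ι ∘ inclX ∘ (Π^tp_X̲ ⊆ Π^tp_X) ∘ plainIso`, `aug := Φ|^{G_K}`;
  the index fields `[Δ̂^±_v : Δ̂_v] = l`, `[Δ̂^cor_v : Δ̂^±_v] = 2l` and the normalities are the kernel facts of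
  `PlusMinusTowerCoverModelCore2` (abc-iut-L2-t8's ambient transport p424475 + abc-iut-L2-t2's index lemma), GRANTED the two
  printed inputs carried as hypotheses: **L02** `hZ : Thm16Sub.KerToZIsCompactlyGenerated` (the printed definition of `Z`, for
  `Π^tp_X̲ ⊴ Π^tp_C`) and **hN** `Π^tp_X̲̲ ⊴ Π^tp_X̲` (arithmetic normality; abc-iut-L2-t7's theorem for the cocycle model under
  `μ_l ⊆ K`, p422309 `XuuCocycleData.doubleUnderline_normal_of_muL`);
* **`PlusMinusTower.ofPiCHat`** — the CANONICAL instance inside abc-iut-L2-d3's `Π_C := e.PiCHat` with `aug := e.piCData.aug` (W3-L2-02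
  phase 2, `MuTwoSettingPiCData`): the tower of record, in the same ambient group as the model's `PiCData` / `TemperedCoverData`;
* the NON-VACUITY theorems (`PlusMinusTower.nonempty_ofUnderline` mod L02 + hN, `nonempty_ofCocycle` mod L02 for abc-iut-L2-t7's cocycle
  model) are the PROOF-ONLY companion `PlusMinusTowerGenuineNonVacuity.lean` (same construction inside a theorem term); this file is the
  NAMED constructor with its rewriting API (`ofCoverModel_fields`, `ofCoverModel_indices`, `ker_coverModelAug`, `coverModelEmb_apply`).

Honest boundary: `Q` is ANY profinite completion of `Π^tp_C` (all are canonically isomorphic — abc-iut-L3's `extension_unique`); the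
tempered groups themselves are abc-iut-L2's INTERFACE data (`MuTwoSetting`, `CLevelData`, `DoubleUnderline`).  Nothing here takes a
side on [IUTchIII] Cor. 3.12; typed ≠ proved; constructed ≠ the paper's reconstruction algorithms.
-/

noncomputable section

namespace Literature.IUT.HodgeArakelov

open Literature.AnabelianGeometry.EtaleTheta Literature.AnabelianGeometry.SemiGraphs

universe u

/-! ## Chosen reference identifications of a Prop. 2.1 output -/

namespace TemperedCoverings

variable {S : BadPlaceSetting.{u}} {P : TopGroup.{u}} (T : TemperedCoverings S P)

/-- A CHOSEN reference identification `P ≅ Π_v` of a Prop. 2.1 output (first component of the field `corresponds`).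
([IUTchII] Prop 2.1, kurims p.65) [claim: Mochizuki2012, status: disputed] -/
def refIso : P ≃ₜ* S.PiX :=
  Classical.choose T.corresponds

/-- A CHOSEN identification `Π^tp_{X_v}(P) ≅ Π^tp_{X_v}` of the ambient group of a Prop. 2.1 output with the reference one, compatible
with `refIso` (second component of the field `corresponds`). ([IUTchII] Prop 2.1, kurims p.65) [claim: Mochizuki2012, status: disputed] -/
def plainIso : T.Xplain ≃ₜ* S.PiXplain :=
  Classical.choose (Classical.choose_spec T.corresponds)

/-- `plainIso ∘ incl = inclPlain ∘ refIso`. ([IUTchII] Prop 2.1, kurims p.65) [claim: Mochizuki2012, status: disputed] -/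
theorem plainIso_incl (x : P) : T.plainIso (T.incl x) = S.inclPlain (T.refIso x) :=
  (Classical.choose_spec (Classical.choose_spec T.corresponds)).1 x

/-- `plainIso(Π^tp_{Y_v}(P)) = Π^tp_{Y_v}` (reference). ([IUTchII] Prop 2.1, kurims p.65) [claim: Mochizuki2012, status: disputed] -/
theorem map_plainIso_Y : T.Y.map T.plainIso.toMulEquiv.toMonoidHom = S.refY :=
  (Classical.choose_spec (Classical.choose_spec T.corresponds)).2.1

/-- `plainIso(Π^tp_{Ÿ_v}(P)) = Π^tp_{Ÿ_v}` (reference). ([IUTchII] Prop 2.1, kurims p.65) [claim: Mochizuki2012, status: disputed] -/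
theorem map_plainIso_Ydd : T.Ydd.map T.plainIso.toMulEquiv.toMonoidHom = S.refYdd :=
  (Classical.choose_spec (Classical.choose_spec T.corresponds)).2.2

end TemperedCoverings

/-! ## The tower -/

namespace PlusMinusTower

variable {p : ℕ} [Fact p.Prime] {M : MuTwoSetting p} (e : M.CLevelData)
  {E : M.toThetaSetting.EtaleThetaData} {l : ℕ} (C : E.DoubleUnderline l) {N : ℕ+}
  (μ : M.toThetaSetting.CyclotomeMod l N) (hC : M.toThetaSetting.Compat) (hS : M.toThetaSetting.Sec2Hyps)
  (hl : l.Prime) (hp2 : p ≠ 2) (hpl : p ≠ l) (hζ : ∃ ζ : M.toThetaSetting.K, IsPrimitiveRoot ζ (4 * l))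
  {η : (C.thetaEnvData μ hC hS).PiYdd → MuN p N} (hη : η ∈ (C.thetaEnvData μ hC hS).thetaCocycles)
  {Q : Type} [Group Q] [TopologicalSpace Q] [IsTopologicalGroup Q]
  (ι : M.GtpC →ₜ* Q) (hι : IsProfiniteCompletion ι) (hinj : Function.Injective ι)
  (Φ : Q →* GQp p) (hΦ : ∀ g : M.GtpC, Φ (ι g) = e.augC g) (hΦK : Φ.range = M.GK)
  (hZ : Thm16Sub.KerToZIsCompactlyGenerated M.toThetaSetting) (hN : (C.Huu.subgroupOf (M.GtpXu l)).Normal)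
  {P : TopGroup.{0}} (T : TemperedCoverings (BadPlaceSetting.ofUnderline C μ hC hS hl hp2 hpl hζ hη) P)

/-- The embedding `Π^tp_{X_v}(P) ≅ Π^tp_X̲ ⊆ Π^tp_X ↪ Π^tp_C → Q` of the tower. ([IUTchII] Def 2.3 (i), kurims p.67) [claim: Mochizuki2012, status: disputed] -/
def coverModelEmb : T.Xplain →* Q :=
  ((ι.toMonoidHom.comp M.inclX).comp (M.GtpXu l).subtype).comp
    (T.plainIso.toMulEquiv.toMonoidHom : T.Xplain →* (M.GtpXu l))

omit [IsTopologicalGroup Q] in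
/-- Value of the embedding. ([IUTchII] Def 2.3 (i), kurims p.67) [claim: Mochizuki2012, status: disputed] -/
theorem coverModelEmb_apply (x : T.Xplain) :
    coverModelEmb C μ hC hS hl hp2 hpl hζ hη ι T x = ι (M.inclX (T.plainIso x).1) :=
  rfl

omit [IsTopologicalGroup Q] in
/-- The embedding is injective when `ι` is. ([IUTchII] Def 2.3 (i), kurims p.67) [claim: Mochizuki2012, status: disputed] -/
theorem coverModelEmb_injective (hinj : Function.Injective ι) :
    Function.Injective (coverModelEmb C μ hC hS hl hp2 hpl hζ hη ι T) :=
  (hinj.comp M.injective_inclX).comp (Subtype.val_injective.comp T.plainIso.injective)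

/-- The range of the embedding lies in `cl ι(inclX Π^tp_X̲)` (indeed in `ι(inclX Π^tp_X̲)`).
([IUTchII] Def 2.3 (i), kurims p.67) [claim: Mochizuki2012, status: disputed] -/
theorem range_coverModelEmb_le :
    (coverModelEmb C μ hC hS hl hp2 hpl hζ hη ι T).range ≤
      (((M.GtpXu l).map M.inclX).map ι.toMonoidHom).topologicalClosure := by
  rintro _ ⟨x, rfl⟩
  exact Subgroup.le_topologicalClosure _ ⟨M.inclX (T.plainIso x).1, ⟨_, (T.plainIso x).2, rfl⟩, rfl⟩

/-- The image of `Π_v = P` under the embedding lies in `cl ι(inclX Π^tp_X̲̲)` (`plainIso ∘ incl = inclPlain ∘ refIso` and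
`inclPlain = (Π^tp_X̲̲ ⊆ Π^tp_X̲)`). ([IUTchII] Def 2.3 (i), kurims p.67) [claim: Mochizuki2012, status: disputed] -/
theorem range_coverModelEmb_comp_incl_le :
    ((coverModelEmb C μ hC hS hl hp2 hpl hζ hη ι T).comp T.incl).range ≤
      ((C.Huu.map M.inclX).map ι.toMonoidHom).topologicalClosure := by
  rintro _ ⟨x, rfl⟩
  refine Subgroup.le_topologicalClosure _ ⟨M.inclX (T.refIso x).1, ⟨_, (T.refIso x).2, rfl⟩, ?_⟩
  change _ = ι (M.inclX (T.plainIso (T.incl x)).1)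
  rw [T.plainIso_incl]
  rfl

omit [IsTopologicalGroup Q] in
/-- The range of the embedding lies in `ι(Π^tp_C)`. ([IUTchII] Def 2.3 (i), kurims p.67) [claim: Mochizuki2012, status: disputed] -/
theorem range_coverModelEmb_le_range :
    (coverModelEmb C μ hC hS hl hp2 hpl hζ hη ι T).range ≤ ι.toMonoidHom.range := by
  rintro _ ⟨x, rfl⟩
  exact ⟨_, rfl⟩

/-- **The augmentation of the tower**, typed over the bundled groups: `Φ` co-restricted to `G_K = G_v` (the setting's `Gk` IS
`G_K ⊆ G_{ℚ_p}` bundled).  ([IUTchII] Def 2.3 (i), kurims p.67) [claim: Mochizuki2012, status: disputed] -/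
def coverModelAug : TopGroup.of Q →* (BadPlaceSetting.ofUnderline C μ hC hS hl hp2 hpl hζ hη).Gk :=
  Φ.codRestrict M.GK fun q => hΦK.le (MonoidHom.mem_range.mpr ⟨q, rfl⟩)

/-- Value of the augmentation in `G_{ℚ_p}`. ([IUTchII] Def 2.3 (i), kurims p.67) [claim: Mochizuki2012, status: disputed] -/
theorem coverModelAug_val (q : Q) : (coverModelAug C μ hC hS hl hp2 hpl hζ hη Φ hΦK q).1 = Φ q :=
  rfl

/-- `Ker` of the augmentation is `Ker Φ` (`= Δ̂^cor_v`). ([IUTchII] Def 2.3 (i), kurims p.67) [claim: Mochizuki2012, status: disputed] -/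
theorem ker_coverModelAug : (coverModelAug C μ hC hS hl hp2 hpl hζ hη Φ hΦK).ker = Φ.ker := by
  ext q
  rw [MonoidHom.mem_ker, MonoidHom.mem_ker]
  constructor
  · intro h
    exact (coverModelAug_val C μ hC hS hl hp2 hpl hζ hη Φ hΦK q).symm.trans (congrArg Subtype.val h)
  · intro h
    exact Subtype.ext ((coverModelAug_val C μ hC hS hl hp2 hpl hζ hη Φ hΦK q).trans h)

/-- The augmentation is surjective (`Φ(Q) = G_K`). ([IUTchII] Def 2.3 (i), kurims p.67) [claim: Mochizuki2012, status: disputed] -/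
theorem coverModelAug_surjective :
    Function.Surjective (coverModelAug C μ hC hS hl hp2 hpl hζ hη Φ hΦK) := by
  intro g
  have hg : g.1 ∈ Φ.range := by rw [hΦK]; exact g.2
  obtain ⟨q, hq⟩ := hg
  exact ⟨q, Subtype.ext hq⟩

include hΦ in
/-- Compatibility of the augmentation with `Π_v ↠ G_v` of the setting through `refIso`:
`Φ(ι(inclX(plainIso (incl x)))) = aug(refIso x)`. ([IUTchII] Def 2.3 (i), kurims p.67) [claim: Mochizuki2012, status: disputed] -/
theorem coverModelAug_compat (x : P) :
    (coverModelAug C μ hC hS hl hp2 hpl hζ hη Φ hΦK (coverModelEmb C μ hC hS hl hp2 hpl hζ hη ι T (T.incl x))).1 =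
      ((BadPlaceSetting.ofUnderline C μ hC hS hl hp2 hpl hζ hη).aug (T.refIso x)).1 := by
  change Φ (ι (M.inclX (T.plainIso (T.incl x)).1)) = M.aug (T.refIso x).1
  rw [T.plainIso_incl, hΦ, e.augC_inclX]
  rfl

/-- **B14 — [IUTchII] Def. 2.3 (i) `±`-TOWER AT `v ∈ V^bad`, GENUINE, from the [EtTh] tempered data** (see the module docstring):
`Π̂^cor_v := Q` (a profinite completion of `Π^tp_C`), `Π^cor_v := ι(Π^tp_C)`, `Π̂^±_v := cl ι(inclX Π^tp_X̲)`, `Π̂_v := cl ι(inclX Π^tp_X̲̲)`,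
`emb := ι ∘ inclX ∘ (Π^tp_X̲ ⊆ Π^tp_X) ∘ plainIso`, `aug := Φ|^{G_K}`; indices `l`, `2l` and normalities from `PlusMinusTowerCoverModelCore2`
GRANTED L02 (`hZ`) and the arithmetic normality hN.  A CONSTRUCTION over landed data and the parameters `ι`, `Φ`.
([IUTchII] Def 2.3 (i), kurims p.67) [claim: Mochizuki2012, status: disputed] -/
def ofCoverModel : PlusMinusTower T where
  Corhat := TopGroup.of Q
  cor := ι.toMonoidHom.range
  pmHat := (((M.GtpXu l).map M.inclX).map ι.toMonoidHom).topologicalClosure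
  hat := ((C.Huu.map M.inclX).map ι.toMonoidHom).topologicalClosure
  emb := coverModelEmb C μ hC hS hl hp2 hpl hζ hη ι T
  emb_injective := coverModelEmb_injective C μ hC hS hl hp2 hpl hζ hη ι T hinj
  aug := coverModelAug C μ hC hS hl hp2 hpl hζ hη Φ hΦK
  aug_surjective := coverModelAug_surjective C μ hC hS hl hp2 hpl hζ hη Φ hΦK
  hat_le_pmHat := Subgroup.topologicalClosure_mono (Subgroup.map_mono (Subgroup.map_mono C.Huu_le_GtpXu))
  emb_le_pmHat := range_coverModelEmb_le C μ hC hS hl hp2 hpl hζ hη ι T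
  embP_le_hat := range_coverModelEmb_comp_incl_le C μ hC hS hl hp2 hpl hζ hη ι T
  embP_le_cor := range_coverModelEmb_le_range C μ hC hS hl hp2 hpl hζ hη ι T
  pmHat_normal := e.normal_closure_GtpXu ι hι hZ l
  deltaHat_normal := by
    rw [ker_coverModelAug]
    exact MuTwoSetting.CLevelData.normal_field ι C hN Φ.ker
  deltaHat_index := by
    rw [ker_coverModelAug]
    exact (e.index_fields ι hι C hZ Φ hΦ fun q => hΦK.le (MonoidHom.mem_range.mpr ⟨q, rfl⟩)).2
  deltaPmHat_normal := by
    rw [ker_coverModelAug]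
    exact e.normal_field_pm ι hι hZ Φ.ker
  deltaPmHat_index := by
    rw [ker_coverModelAug]
    exact (e.index_fields ι hι C hZ Φ hΦ fun q => hΦK.le (MonoidHom.mem_range.mpr ⟨q, rfl⟩)).1
  aug_compat := ⟨T.refIso, fun x => Subtype.ext (coverModelAug_compat e C μ hC hS hl hp2 hpl hζ hη ι Φ hΦ hΦK T x)⟩

/-- The fields of `ofCoverModel`, for rewriting (all `rfl`). ([IUTchII] Def 2.3 (i), kurims p.67) [claim: Mochizuki2012, status: disputed] -/
theorem ofCoverModel_fields :
    (ofCoverModel e C μ hC hS hl hp2 hpl hζ hη ι hι hinj Φ hΦ hΦK hZ hN T).Corhat = TopGroup.of Q ∧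
    (ofCoverModel e C μ hC hS hl hp2 hpl hζ hη ι hι hinj Φ hΦ hΦK hZ hN T).cor = ι.toMonoidHom.range ∧
    (ofCoverModel e C μ hC hS hl hp2 hpl hζ hη ι hι hinj Φ hΦ hΦK hZ hN T).pmHat =
      (((M.GtpXu l).map M.inclX).map ι.toMonoidHom).topologicalClosure ∧
    (ofCoverModel e C μ hC hS hl hp2 hpl hζ hη ι hι hinj Φ hΦ hΦK hZ hN T).hat =
      ((C.Huu.map M.inclX).map ι.toMonoidHom).topologicalClosure ∧
    (ofCoverModel e C μ hC hS hl hp2 hpl hζ hη ι hι hinj Φ hΦ hΦK hZ hN T).emb =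
      coverModelEmb C μ hC hS hl hp2 hpl hζ hη ι T ∧
    (ofCoverModel e C μ hC hS hl hp2 hpl hζ hη ι hι hinj Φ hΦ hΦK hZ hN T).aug =
      coverModelAug C μ hC hS hl hp2 hpl hζ hη Φ hΦK :=
  ⟨rfl, rfl, rfl, rfl, rfl, rfl⟩

/-- **Indices of the constructed tower at the `Π`-level**: `[Π̂^cor_v : Π̂^±_v] = 2l` and `[Π̂^±_v : Π̂_v] = l`.
([IUTchII] Def 2.3 (i), kurims p.67) [claim: Mochizuki2012, status: disputed] -/
theorem ofCoverModel_indices :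
    (ofCoverModel e C μ hC hS hl hp2 hpl hζ hη ι hι hinj Φ hΦ hΦK hZ hN T).pmHat.index = 2 * l ∧
    (ofCoverModel e C μ hC hS hl hp2 hpl hζ hη ι hι hinj Φ hΦ hΦK hZ hN T).hat.relIndex
      (ofCoverModel e C μ hC hS hl hp2 hpl hζ hη ι hι hinj Φ hΦ hΦK hZ hN T).pmHat = l :=
  ⟨e.index_closure_GtpXu ι hι C.l_ne_zero, e.relIndex_closure_Huu_GtpXu ι hι C⟩

/-! ## The tower of record: inside THE profinite completion `Π_C = e.PiCHat` of abc-iut-L2-d3 (W3-L2-02 phase 2) -/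

/-- **B14, CANONICAL INSTANCE — the `±`-tower inside abc-iut-L2-d3's `Π_C := e.PiCHat`** (THE profinite completion of `Π^tp_C` chosen once,
`MuTwoSettingPiCData`: `toPiCHat`, `isProfiniteCompletion_toPiCHat`, `toPiCHat_injective`), with augmentation abc-iut-L2-d3's `e.piCData.aug`
(`piCData_aug_apply`, `PiCData.range_aug`) — so `Π̂^cor_v`, `Π̂^±_v`, `Π̂_v` live in the same group as the model's `PiCData` / `TemperedCoverData`.
GRANTED L02 (`hZ`) and hN.  ([IUTchII] Def 2.3 (i), kurims p.67) [claim: Mochizuki2012, status: disputed] -/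
def ofPiCHat : PlusMinusTower T :=
  ofCoverModel e C μ hC hS hl hp2 hpl hζ hη e.toPiCHat e.isProfiniteCompletion_toPiCHat e.toPiCHat_injective
    e.piCData.aug.toMonoidHom (fun g => e.piCData_aug_apply g) e.piCData.range_aug hZ hN T

/-- The fields of the tower of record (all `rfl`): `Π̂^cor_v = Π_C`, `Π^cor_v = toPiCHat(Π^tp_C)`, `Π̂^±_v = cl toPiCHat(inclX Π^tp_X̲)`,
`Π̂_v = cl toPiCHat(inclX Π^tp_X̲̲)`, `emb x = toPiCHat (inclX (plainIso x))`, `aug = piCData.aug` valued in `G_K`.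
([IUTchII] Def 2.3 (i), kurims p.67) [claim: Mochizuki2012, status: disputed] -/
theorem ofPiCHat_fields :
    (ofPiCHat e C μ hC hS hl hp2 hpl hζ hη hZ hN T).Corhat = TopGroup.of e.PiCHat ∧
    (ofPiCHat e C μ hC hS hl hp2 hpl hζ hη hZ hN T).cor = e.toPiCHat.toMonoidHom.range ∧
    (ofPiCHat e C μ hC hS hl hp2 hpl hζ hη hZ hN T).pmHat =
      (((M.GtpXu l).map M.inclX).map e.toPiCHat.toMonoidHom).topologicalClosure ∧
    (ofPiCHat e C μ hC hS hl hp2 hpl hζ hη hZ hN T).hat =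
      ((C.Huu.map M.inclX).map e.toPiCHat.toMonoidHom).topologicalClosure ∧
    (∀ x, (ofPiCHat e C μ hC hS hl hp2 hpl hζ hη hZ hN T).emb x = e.toPiCHat (M.inclX (T.plainIso x).1)) ∧
    (∀ q, ((ofPiCHat e C μ hC hS hl hp2 hpl hζ hη hZ hN T).aug q).1 = e.piCData.aug q) :=
  ⟨rfl, rfl, rfl, rfl, fun _ => rfl, fun _ => rfl⟩

/-- Indices of the tower of record: `[Π_C : Π̂^±_v] = 2l`, `[Π̂^±_v : Π̂_v] = l`. ([IUTchII] Def 2.3 (i), kurims p.67) [claim: Mochizuki2012, status: disputed] -/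
theorem ofPiCHat_indices :
    (ofPiCHat e C μ hC hS hl hp2 hpl hζ hη hZ hN T).pmHat.index = 2 * l ∧
    (ofPiCHat e C μ hC hS hl hp2 hpl hζ hη hZ hN T).hat.relIndex (ofPiCHat e C μ hC hS hl hp2 hpl hζ hη hZ hN T).pmHat = l :=
  ofCoverModel_indices e C μ hC hS hl hp2 hpl hζ hη _ _ _ _ _ _ hZ hN T

end PlusMinusTower

end Literature.IUT.HodgeArakelov

end
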